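import Summits.NavierStokesRegularity.NavierStokesRegularity.Theorems.ScenarioCensusForward
import Summits.NavierStokesRegularity.NavierStokesRegularity.Theorems.SqueezeCycleSingularZoom
import Summits.NavierStokesRegularity.NavierStokesRegularity.Theorems.ScenarioCensusRowA7h
import HarnessLib

/-!
# Census row F1nv (Type I · Clay · negligible vertical top) — part 1/2: the top predicates, the criterion
# rows F1nv ⊇ F1flat, F1v∞, the residual `VerticalNegligibility`, the split of `Row_F1`

Re-homed for the scenario census (typer seat ns-census-typer-1 g5; lead MINT INTENT F1nv 2026-08-28T15:11Z, ROW
POLICY 15:11Z: ONE row F1nv, F1flat / F1v∞ in-row) from ns-idea-3 g6's LINE 9 «flat-top»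
(`pub/ideators/ns-idea-3/lines/flat-top/line-flat-top.lean`, sha16 89f5a64a93087254, 447 l.; lean check rc 0,
0 sorry; ref g7 PRE-CHECK ✓ 15:16Z; critic idea-crit-3), in two files for the 400-line rule:
this file (§0–§1 of the line) → `ScenarioCensusRowF1nv` (§2 the horizontal singular Type-I zoom limit, §3 the
closures `rowF1nv_holds` / `rowF1flat_holds` / `rowF1vInf_holds`, census keys).  Lean text verbatim in namespace
`…Theorems.ScenarioCensus.FlatTop` (the line's namespace `…Cruxes.ScenarioCensusRowF1.FlatTopLine` re-homed; one
docstring added).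

The split (technique card «splitting / non-equivalent criterion search»), vertical axis `e₃` = coordinate `2` (the
convention of census row A7h `HorizontalMeter.IsHorizontalValued`):
* `HasNegligibleVerticalTop u T` — on the top `{Λ < ‖u‖}` near `T`, `√(T−t)|u₃| ≤ ε` (∀ ε ∃ Λ t₁);
  `HasFlatTop` (`|u₃| ≤ ε‖u‖` on the top), `HasVanishingVerticalRate` (`√(T−t)‖u₃(t)‖_∞ → 0`, no top restriction);
  both imply a negligible vertical top (the first under the Type-I rate);
* criterion rows `Row_F1nv` ⊇ `Row_F1flat`, `Row_F1vInf` = the frame of `ScenarioCensus.Row_F1` verbatim + the top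
  hypothesis ⇒ `HasSmoothExtensionPast`; residual `VerticalNegligibility` (maximal frame), `rowF1_of`
  (criterion + residual ⇒ `Row_F1`), `verticalNegligibility_of_rowF1`.

No census value is asserted here (the lead books F1nv); NS regularity is NOT proved; `Row_F1` stays open; no summit
statement is proved by this file.
-/

noncomputable section

set_option linter.dupNamespace false

open MeasureTheory Set Function Filter TopologicalSpace Metric
open scoped Topology NNReal ENNReal InnerProductSpace RealInnerProductSpace

namespace Summit.NavierStokesRegularity.NavierStokesRegularity.Theorems.ScenarioCensus.FlatTop

open Literature.Analysis Literature.Analysis.FluidPDE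
open Summit.NavierStokesRegularity.NavierStokesRegularity.Theorems
open Summit.NavierStokesRegularity.NavierStokesRegularity.Theorems.ScenarioCensus.HorizontalMeter
  (IsHorizontalValued Row_A7h row_A7h_holds)

/-- `ℝ³`. -/
abbrev E3 := EuclideanSpace ℝ (Fin 3)

/-! ## §0 Two pieces of arithmetic of the parabolic zoom -/

/-- `√(T − (T + c²βt)) = c √(β(−t))` for `c > 0`. [folklore] -/
theorem sqrt_zoom_window {T c β t : ℝ} (hc : 0 < c) :
    Real.sqrt (T - (T + c ^ 2 * β * t)) = c * Real.sqrt (β * (-t)) := by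
  have : T - (T + c ^ 2 * β * t) = c ^ 2 * (β * (-t)) := by ring
  rw [this, Real.sqrt_mul (sq_nonneg _), Real.sqrt_sq hc.le]

/-- The zoomed vertical component inherits the window bound. [folklore] -/
theorem abs_zoom_vert_le {c α s a ε : ℝ} (hc : 0 < c) (hα : 0 < α) (hs : 0 < s)
    (key : c * s * |a| ≤ ε) : |c * α * a| ≤ α * ε / s := by
  rw [le_div_iff₀ hs, abs_mul, abs_of_pos (mul_pos hc hα)]
  calc c * α * |a| * s = α * (c * s * |a|) := by ring
    _ ≤ α * ε := mul_le_mul_of_nonneg_left key hα.le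

/-! ## §1 Negligible vertical top, flat top, vanishing vertical rate; the criterion rows; the residual -/

/-- **Negligible vertical top** (w.r.t. the fixed vertical axis `e₃`): on the top `{Λ < ‖u‖}` near `T`
the vertical component is small at the Type-I scale — `∀ ε ∃ Λ t₁, ∀ t ∈ (t₁,T) ∀ x, Λ < ‖u t x‖ →
√(T−t) |u t x 2| ≤ ε`.  The common weakening of a flat top (under the Type-I rate) and of a vanishing
vertical rate. [cite: KukavicaRusinZiane2016, Cor. 2.3 (p. 4)] -/
def HasNegligibleVerticalTop (u : ℝ → E3 → E3) (T : ℝ) : Prop :=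
  ∀ ε : ℝ, 0 < ε → ∃ Λ t₁ : ℝ, t₁ < T ∧
    ∀ t ∈ Ioo t₁ T, ∀ x : E3, Λ < ‖u t x‖ → Real.sqrt (T - t) * |u t x 2| ≤ ε

/-- **Flat top** («the fast fluid is asymptotically horizontal»): `∀ ε ∃ Λ t₁, ∀ t ∈ (t₁,T) ∀ x,
Λ < ‖u t x‖ → |u t x 2| ≤ ε ‖u t x‖` — the vertical FRACTION of the velocity vanishes on the top.
A plane of values is allowed (horizontally swirling / shearing / counter-streaming fast layers), so a
flat top need be neither one-way nor one-axis. [cite: KukavicaRusinZiane2016, Thm 2.1–2.2 and Cor. 2.3 (pp. 3–4)] -/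
def HasFlatTop (u : ℝ → E3 → E3) (T : ℝ) : Prop :=
  ∀ ε : ℝ, 0 < ε → ∃ Λ t₁ : ℝ, t₁ < T ∧
    ∀ t ∈ Ioo t₁ T, ∀ x : E3, Λ < ‖u t x‖ → |u t x 2| ≤ ε * ‖u t x‖

/-- **Vanishing vertical rate** («`(T−t)^{1/2} ‖u₃(t)‖_{L^∞} → 0` as `t → T`»): the vertical component
stays strictly below the Type-I rate everywhere — the `q = ∞` endpoint of the second alternative of
Kukavica–Rusin–Ziane 2017, Cor. 2.3 failing. [cite: KukavicaRusinZiane2016, Cor. 2.3 (p. 4)] -/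
def HasVanishingVerticalRate (u : ℝ → E3 → E3) (T : ℝ) : Prop :=
  ∀ ε : ℝ, 0 < ε → ∃ t₁ : ℝ, t₁ < T ∧
    ∀ t ∈ Ioo t₁ T, ∀ x : E3, Real.sqrt (T - t) * |u t x 2| ≤ ε

/-- A vanishing vertical rate gives a negligible vertical top (any level). [folklore] -/
theorem HasVanishingVerticalRate.negligibleVerticalTop {u : ℝ → E3 → E3} {T : ℝ}
    (h : HasVanishingVerticalRate u T) : HasNegligibleVerticalTop u T := by
  intro ε hε
  obtain ⟨t₁, ht₁, hb⟩ := h ε hε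
  exact ⟨0, t₁, ht₁, fun t ht x _ => hb t ht x⟩

/-- Under the Type-I rate a flat top is a negligible vertical top. [folklore] -/
theorem HasFlatTop.negligibleVerticalTop {u : ℝ → E3 → E3} {T : ℝ} (hT : 0 < T)
    (hTI : IsTypeIBlowup u T) (h : HasFlatTop u T) : HasNegligibleVerticalTop u T := by
  intro ε hε
  obtain ⟨C, δ, hC, hδ, -, hrate⟩ := exists_typeI_rate_window hT hTI
  obtain ⟨Λ, t₁, ht₁, hflat⟩ := h (ε / (C + 1)) (div_pos hε (by linarith))
  refine ⟨Λ, max t₁ (T - δ), max_lt ht₁ (by linarith), fun t ht x hx => ?_⟩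
  have ht₁t : t ∈ Ioo t₁ T := ⟨(le_max_left _ _).trans_lt ht.1, ht.2⟩
  have hδt : t ∈ Ioo (T - δ) T := ⟨(le_max_right _ _).trans_lt ht.1, ht.2⟩
  have h1 := hflat t ht₁t x hx
  have h2 := hrate t hδt x
  have hs : 0 ≤ Real.sqrt (T - t) := Real.sqrt_nonneg _
  calc Real.sqrt (T - t) * |u t x 2| ≤ Real.sqrt (T - t) * (ε / (C + 1) * ‖u t x‖) :=
        mul_le_mul_of_nonneg_left h1 hs
    _ = ε / (C + 1) * (Real.sqrt (T - t) * ‖u t x‖) := by ring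
    _ ≤ ε / (C + 1) * C := mul_le_mul_of_nonneg_left h2 (div_pos hε (by linarith)).le
    _ ≤ ε := by
        rw [div_mul_eq_mul_div, div_le_iff₀ (by linarith : (0 : ℝ) < C + 1)]
        nlinarith

/-- **Inhabitants** (vacuity check): a horizontal-valued field — e.g. the unbounded horizontal shear
`u t x = (T − t)⁻¹ • e₀`, `e₀ = (1,0,0)` — has a flat top (and a vanishing vertical rate); so the
criterion rows below are populated by fields that blow up at `T` and are genuine restrictions exactly on
blow-ups, while `verticalPersistence_holds` shows no Type-I Navier–Stokes blow-up satisfies them.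
[folklore] -/
theorem hasFlatTop_of_horizontal {u : ℝ → E3 → E3} {T : ℝ} (hu : ∀ t x, u t x 2 = 0) :
    HasFlatTop u T := by
  intro ε hε
  refine ⟨0, T - 1, by linarith, fun t _ x _ => ?_⟩
  rw [hu, abs_zero]
  positivity

/-- A horizontal-valued field has a vanishing vertical rate. [folklore] -/
theorem hasVanishingVerticalRate_of_horizontal {u : ℝ → E3 → E3} {T : ℝ} (hu : ∀ t x, u t x 2 = 0) :
    HasVanishingVerticalRate u T := by
  intro ε hε
  refine ⟨T - 1, by linarith, fun t _ x => ?_⟩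
  rw [hu, abs_zero, mul_zero]
  exact hε.le

/-- Example inhabitant blowing up at `T`: the horizontal shear `u t x = max (T − t)⁻¹ 0 • e₀`,
`e₀ = single 0 1`. [folklore] -/
example (T : ℝ) : HasFlatTop (fun t _ => max (T - t)⁻¹ 0 • (EuclideanSpace.single 0 1 : E3)) T :=
  hasFlatTop_of_horizontal fun t x => by simp

/-- **Criterion row F1nv** (Type I · no symmetry · Clay class · negligible vertical top): the frame of
`ScenarioCensus.Row_F1` verbatim plus `HasNegligibleVerticalTop u T` ⇒ extension past `T`.  PROVED
below (`rowF1nv_holds`). (KochNadirashviliSereginSverak2009, §6 (arXiv:0709.3599); KukavicaRusinZiane2016, Cor. 2.3) -/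
def Row_F1nv : Prop :=
  ∀ (ν T : ℝ), 0 < ν → 0 < T →
    ∀ (u : ℝ → E3 → E3) (p : ℝ → E3 → ℝ),
    IsClassicalNSSolutionOn (Ico 0 T) ν 0 u p → IsLerayHopfOn T ν 0 (u 0) u →
    HasRapidSpatialDecay (u 0) → IsTypeIBlowup u T → HasNegligibleVerticalTop u T →
    HasSmoothExtensionPast ν 0 u T

/-- **Criterion row F1flat** (Type I · Clay · flat top) — PROVED below (`rowF1flat_holds`). (KochNadirashviliSereginSverak2009, §6 (arXiv:0709.3599); KukavicaRusinZiane2016, Thm 2.2) -/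
def Row_F1flat : Prop :=
  ∀ (ν T : ℝ), 0 < ν → 0 < T →
    ∀ (u : ℝ → E3 → E3) (p : ℝ → E3 → ℝ),
    IsClassicalNSSolutionOn (Ico 0 T) ν 0 u p → IsLerayHopfOn T ν 0 (u 0) u →
    HasRapidSpatialDecay (u 0) → IsTypeIBlowup u T → HasFlatTop u T →
    HasSmoothExtensionPast ν 0 u T

/-- **Criterion row F1v∞** (Type I · Clay · `√(T−t)‖u₃(t)‖_∞ → 0`): the `q = ∞` endpoint of
Kukavica–Rusin–Ziane 2017 Cor. 2.3 in the Clay / Type-I frame — PROVED below (`rowF1vInf_holds`). (KukavicaRusinZiane2016, Cor. 2.3 (p. 4); KochNadirashviliSereginSverak2009, §6) -/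
def Row_F1vInf : Prop :=
  ∀ (ν T : ℝ), 0 < ν → 0 < T →
    ∀ (u : ℝ → E3 → E3) (p : ℝ → E3 → ℝ),
    IsClassicalNSSolutionOn (Ico 0 T) ν 0 u p → IsLerayHopfOn T ν 0 (u 0) u →
    HasRapidSpatialDecay (u 0) → IsTypeIBlowup u T → HasVanishingVerticalRate u T →
    HasSmoothExtensionPast ν 0 u T

/-- **Residual** (maximal frame): every Type-I Clay blow-up has a negligible vertical top.  Typed so
that `VerticalNegligibility ↔ Row_F1` (`verticalNegligibility_iff_rowF1`); DECLARED ≡ row F1 — after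
`verticalPersistence_holds` its content is «there is no Type-I Clay blow-up». -/
def VerticalNegligibility : Prop :=
  ∀ (ν T : ℝ), 0 < ν → 0 < T →
    ∀ (u : ℝ → E3 → E3) (p : ℝ → E3 → ℝ),
    IsMaximalSmoothSolution ν 0 u p T → IsLerayHopfOn T ν 0 (u 0) u →
    HasRapidSpatialDecay (u 0) → IsTypeIBlowup u T → HasNegligibleVerticalTop u T

/-- F1nv contains F1flat. [folklore] -/
theorem rowF1flat_of_rowF1nv (h : Row_F1nv) : Row_F1flat :=
  fun ν T hν hT u p hsol hLH hdec hTI hflat =>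
    h ν T hν hT u p hsol hLH hdec hTI (hflat.negligibleVerticalTop hT hTI)

/-- F1nv contains F1v∞. [folklore] -/
theorem rowF1vInf_of_rowF1nv (h : Row_F1nv) : Row_F1vInf :=
  fun ν T hν hT u p hsol hLH hdec hTI hv =>
    h ν T hν hT u p hsol hLH hdec hTI hv.negligibleVerticalTop

/-- **The split**: criterion + residual ⇒ row F1 (by cases on extendability). [folklore] -/
theorem rowF1_of (hD : Row_F1nv) (hR : VerticalNegligibility) : ScenarioCensus.Row_F1 := by
  unfold ScenarioCensus.Row_F1
  intro ν T hν hT u p hsol hLH hdec hTI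
  by_contra hext
  exact hext (hD ν T hν hT u p hsol hLH hdec hTI (hR ν T hν hT u p ⟨hsol, hext⟩ hLH hdec hTI))

/-- The residual is a consequence of the row (vacuously: under `Row_F1` no maximal solution is
Type I). [folklore] -/
theorem verticalNegligibility_of_rowF1 (h : ScenarioCensus.Row_F1) : VerticalNegligibility :=
  fun ν T hν hT u p hmax hLH hdec hTI => (hmax.2 (h ν T hν hT u p hmax.1 hLH hdec hTI)).elim

end Summit.NavierStokesRegularity.NavierStokesRegularity.Theorems.ScenarioCensus.FlatTop

end
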